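import Mathlib
import Literature.Computability.AlgebraicComplexity.Apolarity
import Literature.Computability.AlgebraicComplexity.ApolarityAction
import Literature.Computability.AlgebraicComplexity.StandardFamiliesProofs
import Literature.Computability.AlgebraicComplexity.ApolarityTopPairing
import HarnessLib

/-!
# A border-apolar witness over the padded permanent forces membership in `Δ(det_m)`

Topic `Literature/Computability/AlgebraicComplexity` (border apolarity toolkit; written for route
`ValiantsHypothesis/BorderApolarity`: it is the mathematical content of the support item
`WitnessToMembership` stmt-5782 and makes the crux `FixedWitnessObstructionQP` stmt-5778 a
consequence of the quasi-polynomial Mulmuley–Sohoni thesis).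

`mem_orbitClosure_of_witness`: for `n ≤ m`, if `P_t ∈ GL_{m²}·det_m` is a sequence, `J` satisfies
the limsup clause W3 of the crux in degree `m` (every subsequential coefficientwise limit of
degree-`m` annihilators of the `P_t` lies in `J m`) and `J m ⌟ pp = 0` (W5 in degree `m`,
`pp = X₀₀^{m−n} per_n`), then `pp ∈ Δ(det_m)`.  This is the sufficiency half of border apolarity in
the crux's sequential language and the mathematical content of the route's support item
`WitnessToMembership` (the elementary, sufficiency half of border apolarity for the orbit closure
of `det_m`, cf. Buczyńska–Buczyński 2021 Thm 1 for secant varieties).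

Proof: (1) the top-degree pairing (`apolarAction_eq_zero_iff_sum`) turns
`D ∈ Ann_m(g)` into one linear condition `Σ_d D_d (g_d d!) = 0` on the degree-`m` coefficients;
(2) the weighted coefficient vectors of the `P_t`, normalised to the unit sup-sphere of the
finite coordinate space, have a convergent subsequence `v_{φ t} → u ≠ 0` (`IsCompact.tendsto_subseq`);
(3) every form `D` in the hyperplane `Σ D_d u_d = 0` is a limit of corrected annihilators of the
`P_{φ t}` (`mem_of_sum_eq_zero`), hence lies in `J m` by W3 and kills `pp` by W5; (4) so the
weighted vector of `pp` is proportional to `u` (`exists_smul_of_sum_eq_zero_imp`), and a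
rescaled subsequence `c_t P_{φ t}` converges to `pp` coefficientwise; (5) the orbit `GL·det_m` is
a cone (row scaling, `smul_mem_glOrbit_detPoly`) and Euclidean limits of orbit points lie in the
Zariski orbit closure (`mem_orbitClosure_of_tendsto`).

Adapted (definition-free) from the crux disprover's candidate proof
`Summits/ValiantsHypothesis/ValiantsHypothesis/Cruxes/FixedWitnessObstructionQP/WitnessToMembershipProof.lean`
(refuter cdisprove gen 2).

## References

* W. Buczyńska, J. Buczyński, *Apolarity, border rank, and multigraded Hilbert scheme*, Duke
  Math. J. 170 (2021), Thm 1 / §§3–5. [`BuczynskaBuczynski2021`]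
* K. Mulmuley, M. Sohoni, *Geometric complexity theory I*, SIAM J. Comput. 31 (2001), §4 (orbit
  closures of `det`). [`MulmuleySohoni2001`]
-/

namespace Literature.Computability.AlgebraicComplexity.BorderApolarity

open MvPolynomial Filter
open scoped BigOperators Topology Matrix

noncomputable section

/-! ## Orbit facts for `det` -/

section Orbit

variable {ι : Type*} [Fintype ι] [DecidableEq ι]

/-- Elements of `GL · det` are nonzero. [folklore] -/
theorem ne_zero_of_mem_glOrbit_detPoly {P : MvPolynomial (ι × ι) ℂ}
    (hP : P ∈ glOrbit (ι × ι) ℂ (detPoly ι ℂ)) : P ≠ 0 := by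
  obtain ⟨g, hg⟩ := hP
  intro h
  have h' : linSubstRep (ι × ι) ℂ g (detPoly ι ℂ) = 0 := hg.trans h
  have h2 : linSubstRep (ι × ι) ℂ g⁻¹ (linSubstRep (ι × ι) ℂ g (detPoly ι ℂ)) = detPoly ι ℂ := by
    rw [← Module.End.mul_apply, ← map_mul, inv_mul_cancel, map_one, Module.End.one_apply]
  have h3 : detPoly ι ℂ = 0 := by
    rw [← h2, h', map_zero]
  have hne : detPoly ι ℂ ≠ 0 := by
    simpa [detPoly] using Matrix.det_mvPolynomialX_ne_zero ι ℂ
  exact hne h3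

/-- Elements of `GL · det` are forms of degree `card ι`. [folklore] -/
theorem isHomogeneous_of_mem_glOrbit_detPoly {P : MvPolynomial (ι × ι) ℂ}
    (hP : P ∈ glOrbit (ι × ι) ℂ (detPoly ι ℂ)) : P.IsHomogeneous (Fintype.card ι) := by
  obtain ⟨g, hg⟩ := hP
  rw [← hg]
  show (linSubstRep (ι × ι) ℂ g (detPoly ι ℂ)).IsHomogeneous (Fintype.card ι)
  rw [linSubstRep_apply]
  exact linSubst_isHomogeneous _ detPoly_isHomogeneous

/-- Row scaling `diag(p ↦ [p.1 = i₀] c + [p.1 ≠ i₀])` on a variable. [folklore] -/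
theorem linSubst_rowScale_X (i₀ : ι) (c : ℂ) (p : ι × ι) :
    linSubst (ι × ι) ℂ (Matrix.diagonal fun q : ι × ι => if q.1 = i₀ then c else 1) (X p) =
      (if p.1 = i₀ then c else 1) • X p := by
  rw [linSubst_X, Finset.sum_eq_single p]
  · simp
  · intro q _ hq
    simp [Matrix.diagonal_apply_ne _ hq]
  · intro h; exact absurd (Finset.mem_univ p) h

/-- `c • det = (row scaling of row i₀ by c) · det`: the orbit `GL · det` is a cone. [folklore] -/
theorem linSubst_rowScale_detPoly (i₀ : ι) (c : ℂ) :
    linSubst (ι × ι) ℂ (Matrix.diagonal fun q : ι × ι => if q.1 = i₀ then c else 1) (detPoly ι ℂ) =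
      c • detPoly ι ℂ := by
  rw [detPoly, AlgHom.map_det]
  set X' : Matrix ι ι (MvPolynomial (ι × ι) ℂ) := Matrix.mvPolynomialX ι ι ℂ with hX'
  have hM : (linSubst (ι × ι) ℂ (Matrix.diagonal fun q : ι × ι => if q.1 = i₀ then c else 1)).mapMatrix X' =
      Matrix.updateRow X' i₀ ((C c : MvPolynomial (ι × ι) ℂ) • (fun j => X' i₀ j)) := by
    ext i j
    rw [AlgHom.mapMatrix_apply, Matrix.map_apply, Matrix.updateRow_apply]
    simp only [hX', Matrix.mvPolynomialX_apply, linSubst_rowScale_X]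
    split_ifs with h
    · subst h
      simp [smul_eq_C_mul]
    · simp
  rw [hM, Matrix.det_updateRow_smul, show (fun j => X' i₀ j) = X' i₀ from rfl,
    Matrix.updateRow_eq_self, smul_eq_C_mul]

/-- The orbit `GL · det` is stable under nonzero scalars. [folklore] -/
theorem smul_mem_glOrbit_detPoly [Nonempty ι] {P : MvPolynomial (ι × ι) ℂ}
    (hP : P ∈ glOrbit (ι × ι) ℂ (detPoly ι ℂ)) {c : ℂ} (hc : c ≠ 0) :
    c • P ∈ glOrbit (ι × ι) ℂ (detPoly ι ℂ) := by
  obtain ⟨g, hg⟩ := hP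
  obtain ⟨i₀⟩ := ‹Nonempty ι›
  have hdet : (Matrix.diagonal fun q : ι × ι => if q.1 = i₀ then c else 1).det ≠ 0 := by
    rw [Matrix.det_diagonal, Finset.prod_ne_zero_iff]
    intro p _
    split_ifs <;> simp [hc]
  refine ⟨g * Matrix.GeneralLinearGroup.mkOfDetNeZero _ hdet, ?_⟩
  rw [← hg]
  change linSubstRep (ι × ι) ℂ (g * Matrix.GeneralLinearGroup.mkOfDetNeZero _ hdet) (detPoly ι ℂ) =
    c • linSubstRep (ι × ι) ℂ g (detPoly ι ℂ)
  rw [map_mul, Module.End.mul_apply, linSubstRep_apply, linSubstRep_apply]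
  change linSubst (ι × ι) ℂ (g : Matrix (ι × ι) (ι × ι) ℂ)
      (linSubst (ι × ι) ℂ (Matrix.diagonal fun q : ι × ι => if q.1 = i₀ then c else 1) (detPoly ι ℂ)) =
    c • linSubst (ι × ι) ℂ (g : Matrix _ _ ℂ) (detPoly ι ℂ)
  rw [linSubst_rowScale_detPoly, map_smul]

end Orbit

/-- The padded permanent `X₀₀^{m−n} per_n` is nonzero. [folklore] -/
theorem paddedPerPoly_ne_zero (n m : ℕ) [NeZero m] : paddedPerPoly ℂ n m ≠ 0 := by
  have hinj : Function.Injective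
      (fun ij : BlockIdx n m × BlockIdx n m => ((ij.1 : Fin m), (ij.2 : Fin m))) := by
    intro a b h
    simp only [Prod.mk.injEq] at h
    exact Prod.ext (Subtype.ext h.1) (Subtype.ext h.2)
  have hper : rename (fun ij : BlockIdx n m × BlockIdx n m => ((ij.1 : Fin m), (ij.2 : Fin m)))
      (perPoly (BlockIdx n m) ℂ) ≠ 0 := by
    intro h
    apply perPoly_ne_zero (BlockIdx n m) ℂ
    exact rename_injective _ hinj (by rw [h, map_zero])
  unfold paddedPerPoly
  exact mul_ne_zero (pow_ne_zero _ (X_ne_zero _)) hper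

/-- **Euclidean limits of orbit points lie in the (Zariski) orbit closure**: test polynomials are
continuous in the product topology of the coefficient space. [folklore] -/
theorem mem_orbitClosure_of_tendsto {ι : Type*} [Fintype ι] [DecidableEq ι]
    {f g : MvPolynomial ι ℂ} (Q : ℕ → MvPolynomial ι ℂ) {φ : ℕ → ℕ}
    (hQ : ∀ t, Q t ∈ glOrbit ι ℂ f)
    (hlim : Tendsto (fun t => coeffVec (Q (φ t))) atTop (𝓝 (coeffVec g))) :
    g ∈ orbitClosure f := by
  rw [mem_orbitClosure_iff]
  intro p hp
  have hcont : Continuous fun x : (ι →₀ ℕ) → ℂ => eval x p := continuous_eval p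
  have h1 : Tendsto (fun t => eval (coeffVec (Q (φ t))) p) atTop (𝓝 (eval (coeffVec g) p)) :=
    (hcont.tendsto (coeffVec g)).comp hlim
  have hae : ∀ x : (ι →₀ ℕ) → ℂ, aeval x p = eval x p := fun x => by
    rw [aeval_def]
    rfl
  have h0 : ∀ t, eval (coeffVec (Q (φ t))) p = 0 := fun t => by
    rw [← hae]
    exact hp (Q (φ t)) (hQ (φ t))
  have h3 : Tendsto (fun _ : ℕ => (0 : ℂ)) atTop (𝓝 (eval (coeffVec g) p)) := h1.congr h0
  have h4 : eval (coeffVec g) p = 0 := tendsto_nhds_unique h3 tendsto_const_nhds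
  rw [hae]
  exact h4

/-! ## The coefficient functional `Σ_d D_d w_d` on degree-`j` exponents: linearity bookkeeping -/

section Functional

variable {σ : Type*} [Fintype σ] [DecidableEq σ]

/-- Scaling the weight scales the functional. [folklore] -/
theorem sum_coeff_mul_smul {j : ℕ} (c : ℂ) (w : ((Finset.univ : Finset σ).finsuppAntidiag j) → ℂ)
    (D : MvPolynomial σ ℂ) :
    (∑ d : ((Finset.univ : Finset σ).finsuppAntidiag j), coeff d.1 D * (c • w) d) =
      c * ∑ d : ((Finset.univ : Finset σ).finsuppAntidiag j), coeff d.1 D * w d := by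
  rw [Finset.mul_sum]
  refine Finset.sum_congr rfl fun d _ => ?_
  simp only [Pi.smul_apply, smul_eq_mul]
  ring

/-- Scaling the form scales the functional. [folklore] -/
theorem sum_coeff_smul_mul {j : ℕ} (c : ℂ) (w : ((Finset.univ : Finset σ).finsuppAntidiag j) → ℂ)
    (D : MvPolynomial σ ℂ) :
    (∑ d : ((Finset.univ : Finset σ).finsuppAntidiag j), coeff d.1 (c • D) * w d) =
      c * ∑ d : ((Finset.univ : Finset σ).finsuppAntidiag j), coeff d.1 D * w d := by
  rw [Finset.mul_sum]
  refine Finset.sum_congr rfl fun d _ => ?_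
  rw [coeff_smul, smul_eq_mul]
  ring

/-- The functional is additive (here: subtractive) in the form. [folklore] -/
theorem sum_coeff_sub_mul {j : ℕ} (w : ((Finset.univ : Finset σ).finsuppAntidiag j) → ℂ)
    (D E : MvPolynomial σ ℂ) :
    (∑ d : ((Finset.univ : Finset σ).finsuppAntidiag j), coeff d.1 (D - E) * w d) =
      (∑ d : ((Finset.univ : Finset σ).finsuppAntidiag j), coeff d.1 D * w d) -
        ∑ d : ((Finset.univ : Finset σ).finsuppAntidiag j), coeff d.1 E * w d := by
  rw [← Finset.sum_sub_distrib]
  refine Finset.sum_congr rfl fun d _ => ?_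
  rw [coeff_sub]
  ring

/-- **Corrected annihilators.** Along a subsequence on which the normalised weighted vectors
`v (φ t)` of the forms `P (φ t)` (degree `j`) converge to `u ≠ 0`, every degree-`j` form `D` in the
hyperplane `Σ D_d u_d = 0` is a coefficientwise limit of degree-`j` annihilators of the `P (φ t)`,
hence lies in `J j` by the limsup clause W3. [folklore] -/
theorem mem_of_sum_eq_zero {j : ℕ} {P : ℕ → MvPolynomial σ ℂ} {J : ℕ → Set (MvPolynomial σ ℂ)}
    (hPhom : ∀ t, (P t).IsHomogeneous j)
    (hW3 : ∀ (D : MvPolynomial σ ℂ) (φ : ℕ → ℕ) (Ds : ℕ → MvPolynomial σ ℂ), StrictMono φ →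
      (∀ t, (Ds t).IsHomogeneous j ∧ apolarAction (Ds t) (P (φ t)) = 0) →
      Tendsto (fun t => coeffVec (Ds t)) atTop (𝓝 (coeffVec D)) → D ∈ J j)
    (v : ℕ → (((Finset.univ : Finset σ).finsuppAntidiag j) → ℂ)) (r : ℕ → ℂ)
    (hwv : ∀ t, (fun d : ((Finset.univ : Finset σ).finsuppAntidiag j) =>
      coeff d.1 (P t) * ∏ i ∈ d.1.support, ((d.1 i).factorial : ℂ)) = r t • v t)
    {u : ((Finset.univ : Finset σ).finsuppAntidiag j) → ℂ} (hune : u ≠ 0)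
    {φ : ℕ → ℕ} (hφ : StrictMono φ) (hlim : Tendsto (fun t => v (φ t)) atTop (𝓝 u))
    {D : MvPolynomial σ ℂ} (hD : D.IsHomogeneous j)
    (hLD : (∑ d : ((Finset.univ : Finset σ).finsuppAntidiag j), coeff d.1 D * u d) = 0) :
    D ∈ J j := by
  -- the dual form `E` with coefficients `conj u`, and `κ = Σ conj(u_d) u_d ≠ 0`
  obtain ⟨E, hE⟩ : ∃ E : MvPolynomial σ ℂ,
      E = ∑ e : ((Finset.univ : Finset σ).finsuppAntidiag j), monomial e.1 ((starRingEnd ℂ) (u e)) :=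
    ⟨_, rfl⟩
  have hEhom : E.IsHomogeneous j := hE ▸ isHomogeneous_sum_monomial _
  have hEcoeff : ∀ d : ((Finset.univ : Finset σ).finsuppAntidiag j),
      coeff d.1 E = (starRingEnd ℂ) (u d) := fun d => by
    rw [hE, coeff_sum_monomial]
  -- abbreviation for the functional
  obtain ⟨L, hL⟩ : ∃ L : (((Finset.univ : Finset σ).finsuppAntidiag j) → ℂ) → MvPolynomial σ ℂ → ℂ,
      L = fun w F => ∑ d : ((Finset.univ : Finset σ).finsuppAntidiag j), coeff d.1 F * w d :=
    ⟨_, rfl⟩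
  have hLdef : ∀ w F, L w F = ∑ d : ((Finset.univ : Finset σ).finsuppAntidiag j), coeff d.1 F * w d :=
    fun w F => by rw [hL]
  obtain ⟨κ, hκ⟩ : ∃ κ : ℂ, κ = L u E := ⟨_, rfl⟩
  have hκne : κ ≠ 0 := by
    rw [hκ, hLdef]
    simp only [hEcoeff]
    exact sum_conj_mul_self_ne_zero hune
  obtain ⟨Ds, hDs⟩ : ∃ Ds : ℕ → MvPolynomial σ ℂ,
      ∀ t, Ds t = κ⁻¹ • ((L (v (φ t)) E) • D - (L (v (φ t)) D) • E) := ⟨_, fun t => rfl⟩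
  have hDshom : ∀ t, (Ds t).IsHomogeneous j := by
    intro t
    have hD' := (mem_homogeneousSubmodule j D).2 hD
    have hE' := (mem_homogeneousSubmodule j E).2 hEhom
    rw [hDs, ← mem_homogeneousSubmodule]
    exact Submodule.smul_mem _ _ (Submodule.sub_mem _ (Submodule.smul_mem _ _ hD')
      (Submodule.smul_mem _ _ hE'))
  refine hW3 D φ Ds hφ (fun t => ⟨hDshom t, ?_⟩) ?_
  · -- `Ds t` annihilates `P (φ t)`: its pairing with the weighted vector `r • v (φ t)` vanishes
    rw [apolarAction_eq_zero_iff_sum (hDshom t) (hPhom (φ t))]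
    have hw : ∀ d : ((Finset.univ : Finset σ).finsuppAntidiag j),
        coeff d.1 (P (φ t)) * ∏ i ∈ d.1.support, ((d.1 i).factorial : ℂ) = (r (φ t) • v (φ t)) d :=
      fun d => congrFun (hwv (φ t)) d
    simp only [hw]
    rw [← hLdef, show L (r (φ t) • v (φ t)) (Ds t) = r (φ t) * L (v (φ t)) (Ds t) by
      rw [hLdef, hLdef, sum_coeff_mul_smul], hDs t, hLdef, sum_coeff_smul_mul, sum_coeff_sub_mul,
      sum_coeff_smul_mul, sum_coeff_smul_mul, ← hLdef, ← hLdef]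
    ring
  · -- `Ds t → D` coefficientwise
    have hcL : ∀ F : MvPolynomial σ ℂ, Tendsto (fun t => L (v (φ t)) F) atTop (𝓝 (L u F)) := by
      intro F
      have hc : Continuous fun w : ((Finset.univ : Finset σ).finsuppAntidiag j) → ℂ => L w F := by
        rw [hL]
        exact continuous_sum_coeff_mul _
      exact (hc.tendsto u).comp hlim
    rw [tendsto_pi_nhds]
    intro d
    have hcoord : (fun t => coeffVec (Ds t) d) =
        fun t => κ⁻¹ * (L (v (φ t)) E * coeff d D - L (v (φ t)) D * coeff d E) := by
      funext t
      rw [hDs, coeffVec_apply, coeff_smul, coeff_sub, coeff_smul, coeff_smul]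
      simp only [smul_eq_mul]
    have hlim' : Tendsto (fun t => κ⁻¹ * (L (v (φ t)) E * coeff d D - L (v (φ t)) D * coeff d E))
        atTop (𝓝 (κ⁻¹ * (L u E * coeff d D - L u D * coeff d E))) :=
      (((hcL E).mul tendsto_const_nhds).sub ((hcL D).mul tendsto_const_nhds)).const_mul _
    rw [hcoord]
    have hLuD : L u D = 0 := by rw [hLdef]; exact hLD
    have hval : κ⁻¹ * (L u E * coeff d D - L u D * coeff d E) = coeffVec D d := by
      rw [hLuD, ← hκ, zero_mul, sub_zero, ← mul_assoc, inv_mul_cancel₀ hκne, one_mul, coeffVec_apply]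
    rw [← hval]
    exact hlim'

end Functional

/-! ## The theorem -/

/-- **A witness forces membership** (sufficiency half of border apolarity, sequential form): for
`n ≤ m`, a sequence `P_t ∈ GL·det_m` whose degree-`m` annihilators have all their subsequential
limits in `J m` (W3 at `k = m`), with `J m ⌟ (X₀₀^{m−n} per_n) = 0` (W5 at `k = m`), forces
`X₀₀^{m−n} per_n ∈ Δ(det_m)`.  W1 ∧ W3@m ∧ W5@m suffice; `3 ≤ n`, W2 and W4 are not used.
[folklore] -/
theorem mem_orbitClosure_of_witness {n m : ℕ} [NeZero m] (hnm : n ≤ m)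
    (P : ℕ → MvPolynomial (Fin m × Fin m) ℂ) (J : ℕ → Set (MvPolynomial (Fin m × Fin m) ℂ))
    (hW1 : ∀ t, P t ∈ glOrbit (Fin m × Fin m) ℂ (detPoly (Fin m) ℂ))
    (hW3 : ∀ k ≤ m, ∀ (D : MvPolynomial (Fin m × Fin m) ℂ) (φ : ℕ → ℕ)
      (Ds : ℕ → MvPolynomial (Fin m × Fin m) ℂ), StrictMono φ →
      (∀ t, (Ds t).IsHomogeneous k ∧ apolarAction (Ds t) (P (φ t)) = 0) →
      Tendsto (fun t => coeffVec (Ds t)) atTop (𝓝 (coeffVec D)) → D ∈ J k)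
    (hW5 : ∀ k ≤ m, ∀ D ∈ J k, apolarAction D (paddedPerPoly ℂ n m) = 0) :
    paddedPerPoly ℂ n m ∈ orbitClosure (detPoly (Fin m) ℂ) := by
  have hPhom : ∀ t, (P t).IsHomogeneous m := fun t => by
    simpa [Fintype.card_fin] using isHomogeneous_of_mem_glOrbit_detPoly (hW1 t)
  have hPne : ∀ t, P t ≠ 0 := fun t => ne_zero_of_mem_glOrbit_detPoly (hW1 t)
  -- weighted coefficient vectors `w t`, their norms, and the normalised vectors `v t`
  obtain ⟨w, hw⟩ : ∃ w : ℕ → (((Finset.univ : Finset (Fin m × Fin m)).finsuppAntidiag m) → ℂ),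
      ∀ t, w t = fun d => coeff d.1 (P t) * ∏ i ∈ d.1.support, ((d.1 i).factorial : ℂ) :=
    ⟨_, fun t => rfl⟩
  have hwne : ∀ t, w t ≠ 0 := fun t => by
    rw [hw]; exact weightedCoeff_ne_zero (hPhom t) (hPne t)
  have hnorm : ∀ t, ‖w t‖ ≠ 0 := fun t => norm_ne_zero_iff.2 (hwne t)
  have hnormC : ∀ t, ((‖w t‖ : ℝ) : ℂ) ≠ 0 := fun t => Complex.ofReal_ne_zero.2 (hnorm t)
  obtain ⟨v, hv⟩ : ∃ v : ℕ → (((Finset.univ : Finset (Fin m × Fin m)).finsuppAntidiag m) → ℂ),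
      ∀ t, v t = ((‖w t‖ : ℝ) : ℂ)⁻¹ • w t := ⟨_, fun t => rfl⟩
  have hvs : ∀ t, v t ∈ Metric.sphere
      (0 : ((Finset.univ : Finset (Fin m × Fin m)).finsuppAntidiag m) → ℂ) 1 := by
    intro t
    rw [mem_sphere_zero_iff_norm, hv, norm_smul, norm_inv, Complex.norm_real, norm_norm,
      inv_mul_cancel₀ (hnorm t)]
  obtain ⟨u, hu, φ, hφ, hlim⟩ := (isCompact_sphere _ _).tendsto_subseq hvs
  have hlim1 : Tendsto (fun t => v (φ t)) atTop (𝓝 u) := hlim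
  have hune : u ≠ 0 := by
    intro h
    rw [h, mem_sphere_zero_iff_norm, norm_zero] at hu
    exact zero_ne_one hu
  have hwv : ∀ t, (fun d : ((Finset.univ : Finset (Fin m × Fin m)).finsuppAntidiag m) =>
      coeff d.1 (P t) * ∏ i ∈ d.1.support, ((d.1 i).factorial : ℂ)) = ((‖w t‖ : ℝ) : ℂ) • v t := by
    intro t
    rw [← hw, hv, smul_smul, mul_inv_cancel₀ (hnormC t), one_smul]
  -- Step 1: forms in the hyperplane `Σ D_d u_d = 0` lie in `J m`
  have key : ∀ D : MvPolynomial (Fin m × Fin m) ℂ, D.IsHomogeneous m →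
      (∑ d : ((Finset.univ : Finset (Fin m × Fin m)).finsuppAntidiag m), coeff d.1 D * u d) = 0 →
      D ∈ J m :=
    fun D hD hLD => mem_of_sum_eq_zero hPhom (hW3 m le_rfl) v _ hwv hune hφ hlim1 hD hLD
  -- Step 2: the weighted vector of `pp` is proportional to `u`
  have hpphom : (paddedPerPoly ℂ n m).IsHomogeneous m := paddedPerPoly_isHomogeneous hnm
  have himp : ∀ c : ((Finset.univ : Finset (Fin m × Fin m)).finsuppAntidiag m) → ℂ,
      (∑ d, c d * u d) = 0 →
      (∑ d, c d * (coeff d.1 (paddedPerPoly ℂ n m) * ∏ i ∈ d.1.support, ((d.1 i).factorial : ℂ))) = 0 := by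
    intro c hc
    have hhom := isHomogeneous_sum_monomial (σ := Fin m × Fin m) (j := m) c
    have hD := key _ hhom (by
      simp only [coeff_sum_monomial]
      exact hc)
    have h5 := hW5 m le_rfl _ hD
    rw [apolarAction_eq_zero_iff_sum hhom hpphom] at h5
    simp only [coeff_sum_monomial] at h5
    exact h5
  obtain ⟨μ, hμ⟩ := exists_smul_of_sum_eq_zero_imp u _ hune himp
  have hμne : μ ≠ 0 := by
    rintro rfl
    rw [zero_smul] at hμ
    exact weightedCoeff_ne_zero hpphom (paddedPerPoly_ne_zero n m) hμ
  -- Step 3: the rescaled orbit sequence converges to `pp` coefficientwise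
  obtain ⟨c, hc⟩ : ∃ c : ℕ → ℂ, ∀ t, c t = μ * ((‖w (φ t)‖ : ℝ) : ℂ)⁻¹ := ⟨_, fun t => rfl⟩
  have hcne : ∀ t, c t ≠ 0 := fun t => by
    rw [hc]; exact mul_ne_zero hμne (inv_ne_zero (hnormC (φ t)))
  have hlim2 : Tendsto (fun t => coeffVec (c t • P (φ t))) atTop
      (𝓝 (coeffVec (paddedPerPoly ℂ n m))) := by
    rw [tendsto_pi_nhds]
    intro d
    by_cases hd : d.degree = m
    · have hdmem : d ∈ (Finset.univ : Finset (Fin m × Fin m)).finsuppAntidiag m :=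
        mem_finsuppAntidiag_univ_iff.2 hd
      have hvd : Tendsto (fun t => v (φ t) ⟨d, hdmem⟩) atTop (𝓝 (u ⟨d, hdmem⟩)) :=
        ((continuous_apply _).tendsto u).comp hlim1
      have hfact : (∏ i ∈ d.support, ((d i).factorial : ℂ)) ≠ 0 := prod_factorial_ne_zero d
      have hwd : ∀ t, w t ⟨d, hdmem⟩ = coeff d (P t) * ∏ i ∈ d.support, ((d i).factorial : ℂ) :=
        fun t => by rw [hw]
      have h1 : (fun t => coeffVec (c t • P (φ t)) d) =
          fun t => (μ * (∏ i ∈ d.support, ((d i).factorial : ℂ))⁻¹) * v (φ t) ⟨d, hdmem⟩ := by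
        funext t
        rw [coeffVec_apply, coeff_smul, smul_eq_mul, hc, hv]
        simp only [Pi.smul_apply, smul_eq_mul, hwd]
        field_simp
      have h2 : coeffVec (paddedPerPoly ℂ n m) d =
          (μ * (∏ i ∈ d.support, ((d i).factorial : ℂ))⁻¹) * u ⟨d, hdmem⟩ := by
        have := congrFun hμ ⟨d, hdmem⟩
        simp only [Pi.smul_apply, smul_eq_mul] at this
        rw [coeffVec_apply]
        field_simp
        linear_combination this
      rw [h1, h2]
      exact hvd.const_mul _
    · have h1 : (fun t => coeffVec (c t • P (φ t)) d) = fun _ => 0 := by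
        funext t
        rw [coeffVec_apply, coeff_smul, (hPhom (φ t)).coeff_eq_zero hd, smul_zero]
      have h2 : coeffVec (paddedPerPoly ℂ n m) d = 0 := hpphom.coeff_eq_zero hd
      rw [h1, h2]
      exact tendsto_const_nhds
  -- Step 4: the rescaled sequence stays in the orbit (cone), so `pp` is in the closure
  exact mem_orbitClosure_of_tendsto (φ := id) (fun t => c t • P (φ t))
    (fun t => smul_mem_glOrbit_detPoly (hW1 _) (hcne t)) hlim2

end

end Literature.Computability.AlgebraicComplexity.BorderApolarity
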